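import Mathlib
import HarnessLib
import Summits.NavierStokesRegularity.NavierStokesRegularity.Theses.PoloidalWindowDoor
import Summits.NavierStokesRegularity.NavierStokesRegularity.Theorems.PoloidalWindowDoorLrcModEntireIff
import Summits.NavierStokesRegularity.NavierStokesRegularity.Theorems.PoloidalWindowDoorPoloidalWindowRigidityK2OfLrcSlope
import Summits.NavierStokesRegularity.NavierStokesRegularity.Theorems.PoloidalWindowDoorPoloidalWindowRigidityTimeShearClosed
import Summits.NavierStokesRegularity.NavierStokesRegularity.Theorems.PoloidalWindowDoorPoloidalWindowRigidityEntireGerm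
import Summits.NavierStokesRegularity.NavierStokesRegularity.Theorems.PoloidalWindowDoorLrcModEntireUntwistedGerm
import Summits.NavierStokesRegularity.NavierStokesRegularity.Theorems.PoloidalWindowDoorLrcModEntireTwistingTHLocal
import Summits.NavierStokesRegularity.NavierStokesRegularity.Theorems.PoloidalWindowDoorLrcModEntireTwistingTHLocalHypGerm
import Summits.NavierStokesRegularity.NavierStokesRegularity.Theorems.PoloidalWindowDoorLrcModEntireTwistingTHLocalNonUmbilic
import Summits.NavierStokesRegularity.NavierStokesRegularity.Theorems.PoloidalWindowDoorLrcModEntireTwistingTHLocalGalilean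
import Summits.NavierStokesRegularity.NavierStokesRegularity.Theorems.PoloidalWindowDoorLrcModEntireTwistingTHLocalNormalFormRS
import Summits.NavierStokesRegularity.NavierStokesRegularity.Theorems.PoloidalWindowDoorLrcModEntireTwistingTHSparseGerm
import Summits.NavierStokesRegularity.NavierStokesRegularity.Theorems.PoloidalWindowDoorLrcModEntireTwistingTHSparseNormalForm
import Summits.NavierStokesRegularity.NavierStokesRegularity.Theorems.PoloidalWindowDoorLrcModEntireTwistingTHSparseNormalFormR
import Summits.NavierStokesRegularity.NavierStokesRegularity.Theorems.PoloidalWindowDoorLrcModEntireTwistingTHSparseNormalFormRS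

/-!
# v4.4 (ns-poloidal-K2-p3 g10, 2026-08-28): the (TH) column goes SOURCE-FREE.  Registered stubs: {`stub_scaledEnergy` (= 19708 sparse_energy S1
# VERBATIM, shared), `stub_localTHEmptySFRS` (= v4.3's local statement with the pressure datum `A` REPLACED by the explicit rest-frame source
# `c₂(∂ₜμ − ∂_z²μ) − (c₂²/2)∂_zμ`, one real scalar `c₂`; text = `Lines/twist_split_v44_DRAFT.lean`), `stub_twistingThick`}.  `stub_twistingTH` is DERIVED:
# S1 ⇒ K-sparse energy ⇒ (K2-p2 g8/g9: plane means vanish, `…SparseEnergySourceFreeDatum`, p619942) the (TH) datum is source-free ⇒ `…TwistingTHSparseGerm.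
# stub_twistingTHSparse_of_localEmptyHypSF` (K2-p3 g9, p623876) needs only the LOCAL source-free statement `hemptyHypSF`, which the tree chain
# `…TwistingTHSparseNormalForm{,R,RS}` (K2-p2 g9: p623974, p624404, p624486 — non-umbilic relocation, Galilean boost producing the explicit datum, rotation,
# scaling) reduces to the gauged statement `hemptyHypSF_NFRS` = `stub_localTHEmptySFRS` up to the 10-line adapter `localTHEmptyHypSFNFRS_of_stubSFRS` below.
# The v4.3 road is NOT lost: a certificate for the non-source-free gauged system still closes `stub_twistingTH` through
# `…TwistingTHLocalNormalFormRS.localTHEmptyHypNF_of_normalFormRS` + the v4.2/v4.1 chain (tree), by a one-line swap of the proof of `stub_twistingTH`.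
# Engines: every `a_j` letter becomes `c₂·(n_j − (j+2)(j+1)m_{j+2}) − (c₂²/2)(j+1)m_{j+1}` (rest-frame letters), one new scalar letter `c₂` (weight 1).
#
# v4.3 (ns-poloidal-K2-p3 g9, 2026-08-28): the registered LOCAL statement of the (TH) column is now `stub_localTHEmptyHypNUGRS` =
# v4.2's `stub_localTHEmptyHypNUG` + the ROTATION/SCALING GAUGE VALUES at `p₀`: `∂₀u₂(p₀) = 0`, `∂₁u₂(p₀) = 1` (binder-identical to
# `hemptyHypNFRS` of K2-p2 g8's `…TwistingTHLocalNormalFormRS.localTHEmptyHypNF_of_normalFormRS`, p607457 + `…Scaling` + `…NormalFormRS`);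
# v4.2's statement is DERIVED in-file (`stub_localTHEmptyHypNUG`), so every v4.2/v4.1/v4 closer still applies, and certificates may be
# computed in cert-1's full normal form (u(p₀) = 0, f₀₂ ≠ 0, w₁₀ = −i/2: real letters Rw_1_0 = 0, Iw_1_0 = −1/2).
#
# SKELETON `twist-split` (v4.2: v4.1 with the registered LOCAL statement of the (TH) column in NORMAL FORM — `stub_localTHEmptyHypNUG` =
# v4.1's `stub_localTHEmptyHyp` + the NON-UMBILIC pin `∂₀u₀(p₀) ≠ ∂₁u₁(p₀) ∨ ∂₁u₀(p₀) ≠ 0` + the GALILEAN rest frame `u(p₀) = 0` (K2-p2 g7's free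
# normalisations p585858 `…TwistingTHLocalNonUmbilic` / p586459 `…TwistingTHLocalGalilean`; = CERT-MEMO-4 §0(a)+(e4)'s normal form), ns-poloidal-K2-p3 g8;
# v4.1 (g7) = v4 with the (TH) local statement made HYPERBOLIC (`μ(p₀) < 0`, tree `…TwistingTHLocalHypGerm.stub_twistingTH_of_localEmptyHyp`,
# Theorem A relocation K2-p2 g6 p580224 + the local datum p581814); v4 = v3.1 + the (TH) stub reduced to the local
# statement by `…TwistingTHLocal.stub_twistingTH_of_localEmpty`; the untwisted stub DISCHARGED by p560652) — item `LrcModEntire` (stmt-NavierStokesRegularity-20428 = the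
# promoted stub of crux K2 `PoloidalWindowRigidity`, stmt-19708), route `PoloidalWindowDoor`
# (lead of item 20428: ns-poloidal-K2-p3 g6, 2026-08-27; K2 lead of record on 19708: ns-poloidal-K2-p1 g6, skeleton lrc-jet v5)

`LrcModEntire` (VERBATIM the v3 stub `stub_lrcModEntire`: LRC″ with spatial pins modulo entire unbounded germs, for profiles of
the route's Type-I class poloidal along `e₃`) is re-cut ALONG THE K2 LEAD'S v5 PARTITION BY THE TWIST of the vortex-line foliation,
`T := {∂₂v₂, v₂}ₕ = ∂₀(∂₂v₂)·∂₁v₂ − ∂₁(∂₂v₂)·∂₀v₂` (UNTWISTED-NOTE.md in `Cruxes/PoloidalWindowRigidity/`), instead of v1's partition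
by the dependence of the shear slope (whose two stubs, (TH) and thick, had no mechanism: K2-p2 TH-STEP2, cert-1 CERT-MEMO-2).  Both
halves are stated in the item's GERM currency, so that ONE landing closes the corresponding stub here AND in the K2 lead's skeleton
(`stub_untwisted_of_germStub`, `stub_twisting_of_germStub` below: inside the class every leg of the germ trichotomy forces `v ≡ 0`,
K2-p3 g5 `…LrcModEntireIff.eq_zero_of_germ`, which is absurd on a non-degenerate `W` and a fortiori not backward-singular):

* `stub_untwistedGerm` — class + poloidal + nonempty open non-degenerate `W` on which `T ≡ 0` ⇒ the germ trichotomy.  NO slope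
  hypothesis.  PROVED ON PAPER (UNTWISTED-NOTE §3); Lean bricks: F1 `…UntwistedKinematics` (K2-p3 g6, p550415), F3a/F3b
  `…UntwistedSeparation{,2}` (lead, p548007/p548501), F5 `…UntwistedSliceGlue` (K2-p3 g5, p548451) + `…UntwistedIsoparametric`
  (K2-p3 g6: isoparametric leaves ⇒ rotation/translation germ of `v₂(s,·)` ⇒ Clebsch `ψ` germ ⇒ vorticity germ = THIS stub's
  conclusion, `lrcGerm_of_leafwise`), F2 `…StructureFunctionDynamics` ((K1)+(V0), lead/K2-p2) and F4 (branch 2b, lead) outstanding.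
* `stub_twistingTH` / `stub_twistingThick` (v3: v2's single `stub_twistingGerm` cut along the slope stratum, matching the two work lanes)
  — class + poloidal + nonempty open non-degenerate `W` + the item's pin + `T ≠ 0` pointwise on `W` + EITHER (TH) «slope a function of
  `(t, x₂)` on `W`» OR thick «slope a function of `(t, x₂)` on no open subset of `W`» ⇒ the germ trichotomy; `twistingGerm_of_stubs`
  recombines them (slope dichotomy, proved) into v2's twisting statement (= the K2 lead's `stub_twisting` in germ currency, transfer
  `stub_twisting_of_germStub`).  THE RESEARCH RESIDUE.  (TH) ∩ twisting: a finite exact-elimination certificate is expected (K2-p2 g4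
  RESULT B: jet collapse at N* = 12 onto untwisted families; nsreg-p7 g10/g11 Janet completion; cert-1 g3 census (2)); thick ∩ twisting:
  open (UNTWISTED-NOTE §5 frame system; AXIS theorem for «twisting ∧ isoparametric»; cert-1 g3 censuses (1)/(4); refuter1 K-a‴).
* `LrcModEntire_of_twistSplit` — COMPOSITION (proved, no singularity used): `T` is jointly continuous on the slab (the Jacobian
  entries of a class profile and their spatial derivatives are jointly analytic: `…K2OfLrcSlope.analyticOnNhd_uncurry_fderiv_entry`,
  `…AnalyticPropagation.analyticOnNhd_uncurry_fderiv_slice_apply`), so either `T ≡ 0` on `W` (first stub, the pin is dropped) or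
  `W ∩ {T ≠ 0}` is a nonempty open admissible set (the twisting pair via `twistingGerm_of_stubs`).
* `stub_untwisted_of_germStub`, `stub_twisting_of_germStub` — TRANSFER: each germ stub, as a fully quantified hypothesis, implies
  VERBATIM the K2 lead's v5 stub of 19708 (`¬ IsBackwardSingularPoint` currency); `lrcModEntire_holds_of_twistSplit` — K2 from the
  item (tree `…TimeShearClosed.nonflatLiouville_of_lrcSpatial` + `…EntireGerm`), unchanged from v1.

WHAT THIS IS NOT: not a proof of `LrcModEntire` or of K2 — a registered three-stub partition of the promoted item; the first stub is
paper-proved with its Lean chain in the tree modulo brick F2c and the Stuart-branch file, the two twisting stubs are research-sized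
(pure non-existence statements).
-/

-- the summit and its single sub-problem share the name (CONVENTIONS §1)
set_option linter.dupNamespace false

namespace Summit.NavierStokesRegularity.NavierStokesRegularity.Theses.PoloidalWindowDoor

open Set Function
open scoped RealInnerProductSpace InnerProductSpace Laplacian
open Literature.Analysis Literature.Analysis.FluidPDE
open Summit.NavierStokesRegularity.NavierStokesRegularity.Theorems.PoloidalWindowDoorPoloidalWindowRigidityEntireGerm
open Summit.NavierStokesRegularity.NavierStokesRegularity.Theorems.PoloidalWindowDoorLrcModEntireIff
open Summit.NavierStokesRegularity.NavierStokesRegularity.Theorems.PoloidalWindowDoorPoloidalWindowRigidityK2OfLrcSlope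
open Summit.NavierStokesRegularity.NavierStokesRegularity.Theorems.TubeAlternative.AnalyticPropagation
open Summit.NavierStokesRegularity.NavierStokesRegularity.Theorems.PoloidalWindowDoorPoloidalWindowRigidityFlat

/-- **STUB: NON-DEGENERATE + UNTWISTED ⇒ the germ trichotomy — PROVED IN THE TREE (p560652
`…Theorems.PoloidalWindowDoorLrcModEntireUntwistedGerm.stub_untwistedGerm`, 2026-08-27T19:17Z; paper proof UNTWISTED-NOTE §3).**  For a profile of the route's Type-I class, poloidal along `e₃`: on a nonempty open space–time subset `W`
of the backward slab on which the profile is non-degenerate (`curl v ≠ 0`, `∇ₕv₂ ≠ 0`, `∂₂vₕ ≠ 0` pointwise) and the twist bracket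
`{∂₂v₂, v₂}ₕ = ∂₀(∂₂v₂)·∂₁v₂ − ∂₁(∂₂v₂)·∂₀v₂` vanishes pointwise, SOME slice `s < 0` carries on a nonempty open `U` a translation germ
of the vorticity, or a rotation germ about a vertical axis, or `v(s)` agrees on `U` with an entire real-analytic field unbounded on `ℝ³`.
No hypothesis on the shear slope.  Mechanism: `∂₂v₂ = P(v₂,x₂)` (F1) ⇒ separation of variables in the height (F3, F4) ⇒ isoparametric
leaves ⇒ planar Levi-Civita–Segre + vertical propagation ⇒ rotation/translation germ of `v₂(s,·)` ⇒ of the Clebsch stream function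
⇒ of the vorticity (F5 `…UntwistedIsoparametric.lrcGerm_of_leafwise`). -/
theorem stub_untwistedGerm :
    ∀ (C : ℝ) (v : ℝ → EuclideanSpace ℝ (Fin 3) → EuclideanSpace ℝ (Fin 3)),
      Literature.Analysis.FluidPDE.HasTypeITimeDecay C v →
      ContinuousOn (Function.uncurry v) (Set.Iio (0 : ℝ) ×ˢ Set.univ) →
      (∀ s t : ℝ, s < t → t < 0 → ∀ x, v t x =
        Literature.Analysis.UnboundedOperators.heatExtension (v s) (t - s) x -
          Literature.Analysis.FluidPDE.oseenDuhamel 1 s v v t x) →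
      (∀ t < 0, Literature.Analysis.FluidPDE.VectorCalculus.IsDivFree (v t)) →
      (∀ s < 0, ∀ y, ⟪Literature.Analysis.FluidPDE.curl (v s) y, EuclideanSpace.single 2 1⟫_ℝ = 0) →
      ∀ W : Set (ℝ × EuclideanSpace ℝ (Fin 3)), IsOpen W → W.Nonempty → W ⊆ Set.Iio (0 : ℝ) ×ˢ Set.univ →
        (∀ z ∈ W, Literature.Analysis.FluidPDE.curl (v z.1) z.2 ≠ 0 ∧
          (fderiv ℝ (v z.1) z.2 (EuclideanSpace.single 0 1) 2 ≠ 0 ∨ fderiv ℝ (v z.1) z.2 (EuclideanSpace.single 1 1) 2 ≠ 0) ∧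
          (fderiv ℝ (v z.1) z.2 (EuclideanSpace.single 2 1) 0 ≠ 0 ∨ fderiv ℝ (v z.1) z.2 (EuclideanSpace.single 2 1) 1 ≠ 0)) →
        (∀ z ∈ W,
          fderiv ℝ (fun x => fderiv ℝ (v z.1) x (EuclideanSpace.single 2 1) 2) z.2 (EuclideanSpace.single 0 1) *
              fderiv ℝ (v z.1) z.2 (EuclideanSpace.single 1 1) 2 -
            fderiv ℝ (fun x => fderiv ℝ (v z.1) x (EuclideanSpace.single 2 1) 2) z.2 (EuclideanSpace.single 1 1) *
              fderiv ℝ (v z.1) z.2 (EuclideanSpace.single 0 1) 2 = 0) →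
        ∃ s : ℝ, s < 0 ∧ ∃ U : Set (EuclideanSpace ℝ (Fin 3)), IsOpen U ∧ U.Nonempty ∧
          ((∃ e : EuclideanSpace ℝ (Fin 3), e ≠ 0 ∧
              ∀ y ∈ U, fderiv ℝ (Literature.Analysis.FluidPDE.curl (v s)) y e = 0) ∨
           (∃ c : EuclideanSpace ℝ (Fin 3), ∀ y ∈ U,
              Literature.Analysis.FluidPDE.rotGen (Literature.Analysis.FluidPDE.curl (v s) y) =
                fderiv ℝ (Literature.Analysis.FluidPDE.curl (v s)) y (Literature.Analysis.FluidPDE.rotGen (y - c))) ∨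
           (∃ w : EuclideanSpace ℝ (Fin 3) → EuclideanSpace ℝ (Fin 3), AnalyticOnNhd ℝ w Set.univ ∧
              ¬ BddAbove (Set.range fun y => ‖w y‖) ∧ ∀ y ∈ U, v s y = w y)) :=
  Summit.NavierStokesRegularity.NavierStokesRegularity.Theorems.PoloidalWindowDoorLrcModEntireUntwistedGerm.stub_untwistedGerm

/-- **STUB S1 (v4.4, shared VERBATIM with crux 19708's line `sparse_energy`): THE SCALE-INVARIANT ENERGY OF A CLASS PROFILE IS K-SPARSE.**
For a profile of the route's Type-I class there is `K ≥ 0` with `∫_{B(a,R)} |v(t₀)|² ≤ K·R` and `∫_{t<t₀}∫_{B(a,R)} ‖Dv‖² ≤ K·R` for every ball and every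
`t₀ < 0`.  Far-from-the-apex half (`t₀ ≤ −R²`) is the tree theorem `…SparseEnergyFarField.scaledEnergy_far` (K2-p2 g9, p621713); the near-apex half is
K2-p2's S1-NEAR-DESIGN (KNSS pressure modulo constants + a three-round flux bootstrap).  One landing closes this stub here AND S1 of 19708. -/
theorem stub_scaledEnergy :
    ∀ (C : ℝ) (v : ℝ → EuclideanSpace ℝ (Fin 3) → EuclideanSpace ℝ (Fin 3)),
      Literature.Analysis.FluidPDE.HasTypeITimeDecay C v →
      ContinuousOn (Function.uncurry v) (Set.Iio (0 : ℝ) ×ˢ Set.univ) →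
      (∀ s t : ℝ, s < t → t < 0 → ∀ x, v t x =
        Literature.Analysis.UnboundedOperators.heatExtension (v s) (t - s) x -
          Literature.Analysis.FluidPDE.oseenDuhamel 1 s v v t x) →
      (∀ t < 0, Literature.Analysis.FluidPDE.VectorCalculus.IsDivFree (v t)) →
      ∃ K : ℝ, 0 ≤ K ∧ ∀ t₀ : ℝ, t₀ < 0 → ∀ (a : EuclideanSpace ℝ (Fin 3)) (R : ℝ), 0 < R →
        (∫⁻ x in Metric.ball a R, ENNReal.ofReal (‖v t₀ x‖ ^ 2)) ≤ ENNReal.ofReal (K * R) ∧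
        (∫⁻ t in Set.Iio t₀, ∫⁻ x in Metric.ball a R, ENNReal.ofReal (‖fderiv ℝ (v t) x‖ ^ 2)) ≤ ENNReal.ofReal (K * R) := by
  sorry

/-- **STUB (v4.4): THE SOURCE-FREE LOCAL *HYPERBOLIC* (TH)∩TWISTING SYSTEM IS EMPTY AT A NON-UMBILIC REST POINT IN THE ROTATION/SCALING GAUGE**
— the by-name TARGET of the (TH) column.  = v4.3's `stub_localTHEmptyHypNUGRS` with the free analytic pressure datum `A(t,z)` REPLACED by the explicit
source `c₂·(∂ₜμ − ∂_z²μ)(t,z) − (c₂²/2)·∂_zμ(t,z)` for ONE real scalar `c₂` (the vertical velocity at the base point before the Galilean boost; `μ` is the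
rest-frame slope).  Text = `Lines/twist_split_v44_DRAFT.lean` (K2-p3 g9, sign kernel-checked by K2-p2 g9 `…TwistingTHSparseBoost.boostedDatum_eq`).
Kill test: an explicit real-analytic local solution of the four laws with THIS datum, twist ≠ 0, μ ∉ {0,1}, μ_z ≠ 0, μ < 0 (WLOG Φ₂(p₀) ≠ 0, u(p₀) = 0,
∇ₕu₂(p₀) = e₁). -/
theorem stub_localTHEmptySFRS :
    ∀ (u : ℝ → EuclideanSpace ℝ (Fin 3) → EuclideanSpace ℝ (Fin 3)) (μ : ℝ → ℝ → ℝ) (c₂ : ℝ)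
      (U : Set (ℝ × EuclideanSpace ℝ (Fin 3))) (p₀ : ℝ × EuclideanSpace ℝ (Fin 3)),
      IsOpen U → p₀ ∈ U →
      AnalyticOnNhd ℝ (Function.uncurry u) U →
      (∀ p ∈ U, AnalyticAt ℝ (Function.uncurry μ) (p.1, p.2 2)) →
      (∀ p ∈ U, fderiv ℝ (u p.1) p.2 (EuclideanSpace.single 0 1) 1 = fderiv ℝ (u p.1) p.2 (EuclideanSpace.single 1 1) 0) →
      (∀ p ∈ U, fderiv ℝ (u p.1) p.2 (EuclideanSpace.single 0 1) 0 + fderiv ℝ (u p.1) p.2 (EuclideanSpace.single 1 1) 1 +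
        fderiv ℝ (u p.1) p.2 (EuclideanSpace.single 2 1) 2 = 0) →
      (∀ p ∈ U, ∀ b : Fin 3, b ≠ 2 →
        fderiv ℝ (u p.1) p.2 (EuclideanSpace.single 2 1) b =
          μ p.1 (p.2 2) * fderiv ℝ (u p.1) p.2 (EuclideanSpace.single b 1) 2) →
      (∀ p ∈ U,
        (1 - μ p.1 (p.2 2)) *
            (deriv (fun s => u s p.2 2) p.1 + fderiv ℝ (fun y => u p.1 y 2) p.2 (u p.1 p.2)
              - Δ (fun y => u p.1 y 2) p.2) =
          (c₂ * (deriv (fun s => μ s (p.2 2)) p.1 - deriv (deriv (μ p.1)) (p.2 2)) -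
            c₂ ^ 2 / 2 * deriv (μ p.1) (p.2 2)) + (deriv (fun s => μ s (p.2 2)) p.1 - deriv (deriv (μ p.1)) (p.2 2)) * u p.1 p.2 2
            + deriv (μ p.1) (p.2 2) / 2 * u p.1 p.2 2 ^ 2
            - 2 * deriv (μ p.1) (p.2 2) * fderiv ℝ (u p.1) p.2 (EuclideanSpace.single 2 1) 2) →
      fderiv ℝ (fun y => fderiv ℝ (u p₀.1) y (EuclideanSpace.single 2 1) 2) p₀.2 (EuclideanSpace.single 0 1) *
            fderiv ℝ (u p₀.1) p₀.2 (EuclideanSpace.single 1 1) 2 -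
          fderiv ℝ (fun y => fderiv ℝ (u p₀.1) y (EuclideanSpace.single 2 1) 2) p₀.2 (EuclideanSpace.single 1 1) *
            fderiv ℝ (u p₀.1) p₀.2 (EuclideanSpace.single 0 1) 2 ≠ 0 →
      μ p₀.1 (p₀.2 2) ≠ 0 → μ p₀.1 (p₀.2 2) ≠ 1 → deriv (μ p₀.1) (p₀.2 2) ≠ 0 →
      μ p₀.1 (p₀.2 2) < 0 →
      (fderiv ℝ (u p₀.1) p₀.2 (EuclideanSpace.single 0 1) 0 ≠ fderiv ℝ (u p₀.1) p₀.2 (EuclideanSpace.single 1 1) 1 ∨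
        fderiv ℝ (u p₀.1) p₀.2 (EuclideanSpace.single 1 1) 0 ≠ 0) →
      u p₀.1 p₀.2 = 0 → 
      fderiv ℝ (u p₀.1) p₀.2 (EuclideanSpace.single 0 1) 2 = 0 →
      fderiv ℝ (u p₀.1) p₀.2 (EuclideanSpace.single 1 1) 2 = 1 → False := by
  sorry

/-- **Adapter (v4.4): K2-p2 g9's gauged source-free statement `hemptyHypSF_NFRS` (hypothesis `hS` of `…TwistingTHSparseNormalFormRS.rotationSF_of_scalingSF`,
with the datum as `∃ k, A = k(∂ₜμ − ∂_z²μ) − (k²/2)∂_zμ`) FROM the registered stub `stub_localTHEmptySFRS` (datum substituted, `c₂` a binder): instantiate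
`c₂ := k` and rewrite the vertical law with the datum identity. -/
theorem localTHEmptyHypSFNFRS_of_stubSFRS :
    ∀ (u : ℝ → EuclideanSpace ℝ (Fin 3) → EuclideanSpace ℝ (Fin 3)) (μ A : ℝ → ℝ → ℝ)
      (U : Set (ℝ × EuclideanSpace ℝ (Fin 3))) (p₀ : ℝ × EuclideanSpace ℝ (Fin 3)),
      IsOpen U → p₀ ∈ U →
      AnalyticOnNhd ℝ (Function.uncurry u) U →
      (∀ p ∈ U, AnalyticAt ℝ (Function.uncurry μ) (p.1, p.2 2)) →
      (∀ p ∈ U, AnalyticAt ℝ (Function.uncurry A) (p.1, p.2 2)) →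
      (∀ p ∈ U, fderiv ℝ (u p.1) p.2 (EuclideanSpace.single 0 1) 1 = fderiv ℝ (u p.1) p.2 (EuclideanSpace.single 1 1) 0) →
      (∀ p ∈ U, fderiv ℝ (u p.1) p.2 (EuclideanSpace.single 0 1) 0 + fderiv ℝ (u p.1) p.2 (EuclideanSpace.single 1 1) 1 +
        fderiv ℝ (u p.1) p.2 (EuclideanSpace.single 2 1) 2 = 0) →
      (∀ p ∈ U, ∀ b : Fin 3, b ≠ 2 →
        fderiv ℝ (u p.1) p.2 (EuclideanSpace.single 2 1) b =
          μ p.1 (p.2 2) * fderiv ℝ (u p.1) p.2 (EuclideanSpace.single b 1) 2) →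
      (∀ p ∈ U,
        (1 - μ p.1 (p.2 2)) *
            (deriv (fun s => u s p.2 2) p.1 + fderiv ℝ (fun y => u p.1 y 2) p.2 (u p.1 p.2)
              - Δ (fun y => u p.1 y 2) p.2) =
          A p.1 (p.2 2) + (deriv (fun s => μ s (p.2 2)) p.1 - deriv (deriv (μ p.1)) (p.2 2)) * u p.1 p.2 2
            + deriv (μ p.1) (p.2 2) / 2 * u p.1 p.2 2 ^ 2
            - 2 * deriv (μ p.1) (p.2 2) * fderiv ℝ (u p.1) p.2 (EuclideanSpace.single 2 1) 2) →
      fderiv ℝ (fun y => fderiv ℝ (u p₀.1) y (EuclideanSpace.single 2 1) 2) p₀.2 (EuclideanSpace.single 0 1) *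
            fderiv ℝ (u p₀.1) p₀.2 (EuclideanSpace.single 1 1) 2 -
          fderiv ℝ (fun y => fderiv ℝ (u p₀.1) y (EuclideanSpace.single 2 1) 2) p₀.2 (EuclideanSpace.single 1 1) *
            fderiv ℝ (u p₀.1) p₀.2 (EuclideanSpace.single 0 1) 2 ≠ 0 →
      μ p₀.1 (p₀.2 2) ≠ 0 → μ p₀.1 (p₀.2 2) ≠ 1 → deriv (μ p₀.1) (p₀.2 2) ≠ 0 →
      μ p₀.1 (p₀.2 2) < 0 →
      (∃ k : ℝ, ∀ p ∈ U, A p.1 (p.2 2) =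
        k * (deriv (fun s => μ s (p.2 2)) p.1 - deriv (deriv (μ p.1)) (p.2 2)) - k ^ 2 / 2 * deriv (μ p.1) (p.2 2)) →
      (fderiv ℝ (u p₀.1) p₀.2 (EuclideanSpace.single 0 1) 0 ≠ fderiv ℝ (u p₀.1) p₀.2 (EuclideanSpace.single 1 1) 1 ∨
        fderiv ℝ (u p₀.1) p₀.2 (EuclideanSpace.single 1 1) 0 ≠ 0) →
      u p₀.1 p₀.2 = 0 →
      fderiv ℝ (u p₀.1) p₀.2 (EuclideanSpace.single 0 1) 2 = 0 →
      fderiv ℝ (u p₀.1) p₀.2 (EuclideanSpace.single 1 1) 2 = 1 → False := by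
  intro u μ A U p₀ hU hp₀ hu hμ _hA hpol hdiv hslope hE htw hμ0 hμ1 hμz hμneg hk hNU hrest h02 h12
  obtain ⟨k, hAk⟩ := hk
  refine stub_localTHEmptySFRS u μ k U p₀ hU hp₀ hu hμ hpol hdiv hslope ?_ htw hμ0 hμ1 hμz hμneg hNU hrest h02 h12
  intro p hp
  have h := hE p hp
  rw [hAk p hp] at h
  exact h

/-- **The LOCAL source-free statement `hemptyHypSF` (hypothesis of K2-p3 g9's `…TwistingTHSparseGerm.stub_twistingTHSparse_of_localEmptyHypSF`, p623876)
FROM the registered gauged stub**, by K2-p2 g9's normal-form chain: non-umbilic relocation (`localTHEmptyHypSF_of_nonUmbilicSF`), Galilean boost producing the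
explicit datum (`nonUmbilicSF_of_galileanSF`, p623974), rotation (`galileanSF_of_rotationSF`, p624404), scaling (`rotationSF_of_scalingSF`, p624486). -/
theorem localTHEmptyHypSF_of_stubs :
    ∀ (u : ℝ → EuclideanSpace ℝ (Fin 3) → EuclideanSpace ℝ (Fin 3)) (μ A : ℝ → ℝ → ℝ)
      (U : Set (ℝ × EuclideanSpace ℝ (Fin 3))) (p₀ : ℝ × EuclideanSpace ℝ (Fin 3)),
      IsOpen U → p₀ ∈ U →
      AnalyticOnNhd ℝ (Function.uncurry u) U →
      (∀ p ∈ U, AnalyticAt ℝ (Function.uncurry μ) (p.1, p.2 2)) →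
      (∀ p ∈ U, AnalyticAt ℝ (Function.uncurry A) (p.1, p.2 2)) →
      (∀ p ∈ U, fderiv ℝ (u p.1) p.2 (EuclideanSpace.single 0 1) 1 = fderiv ℝ (u p.1) p.2 (EuclideanSpace.single 1 1) 0) →
      (∀ p ∈ U, fderiv ℝ (u p.1) p.2 (EuclideanSpace.single 0 1) 0 + fderiv ℝ (u p.1) p.2 (EuclideanSpace.single 1 1) 1 +
        fderiv ℝ (u p.1) p.2 (EuclideanSpace.single 2 1) 2 = 0) →
      (∀ p ∈ U, ∀ b : Fin 3, b ≠ 2 →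
        fderiv ℝ (u p.1) p.2 (EuclideanSpace.single 2 1) b =
          μ p.1 (p.2 2) * fderiv ℝ (u p.1) p.2 (EuclideanSpace.single b 1) 2) →
      (∀ p ∈ U,
        (1 - μ p.1 (p.2 2)) *
            (deriv (fun s => u s p.2 2) p.1 + fderiv ℝ (fun y => u p.1 y 2) p.2 (u p.1 p.2)
              - Δ (fun y => u p.1 y 2) p.2) =
          A p.1 (p.2 2) + (deriv (fun s => μ s (p.2 2)) p.1 - deriv (deriv (μ p.1)) (p.2 2)) * u p.1 p.2 2
            + deriv (μ p.1) (p.2 2) / 2 * u p.1 p.2 2 ^ 2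
            - 2 * deriv (μ p.1) (p.2 2) * fderiv ℝ (u p.1) p.2 (EuclideanSpace.single 2 1) 2) →
      fderiv ℝ (fun y => fderiv ℝ (u p₀.1) y (EuclideanSpace.single 2 1) 2) p₀.2 (EuclideanSpace.single 0 1) *
            fderiv ℝ (u p₀.1) p₀.2 (EuclideanSpace.single 1 1) 2 -
          fderiv ℝ (fun y => fderiv ℝ (u p₀.1) y (EuclideanSpace.single 2 1) 2) p₀.2 (EuclideanSpace.single 1 1) *
            fderiv ℝ (u p₀.1) p₀.2 (EuclideanSpace.single 0 1) 2 ≠ 0 →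
      μ p₀.1 (p₀.2 2) ≠ 0 → μ p₀.1 (p₀.2 2) ≠ 1 → deriv (μ p₀.1) (p₀.2 2) ≠ 0 →
      μ p₀.1 (p₀.2 2) < 0 → 
      (∀ p ∈ U, A p.1 (p.2 2) = 0) → False :=
  Summit.NavierStokesRegularity.NavierStokesRegularity.Theorems.PoloidalWindowDoorLrcModEntireTwistingTHSparseNormalForm.localTHEmptyHypSF_of_nonUmbilicSF
    (Summit.NavierStokesRegularity.NavierStokesRegularity.Theorems.PoloidalWindowDoorLrcModEntireTwistingTHSparseNormalForm.nonUmbilicSF_of_galileanSF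
      (Summit.NavierStokesRegularity.NavierStokesRegularity.Theorems.PoloidalWindowDoorLrcModEntireTwistingTHSparseNormalFormR.galileanSF_of_rotationSF
        (Summit.NavierStokesRegularity.NavierStokesRegularity.Theorems.PoloidalWindowDoorLrcModEntireTwistingTHSparseNormalFormRS.rotationSF_of_scalingSF
          localTHEmptyHypSFNFRS_of_stubSFRS)))

/-- **NON-DEGENERATE + PIN + TWISTING on the TIME–HEIGHT STRATUM (TH) ⇒ the germ trichotomy — v4.4: PROVED MODULO `stub_scaledEnergy` + `stub_localTHEmptySFRS`** (S1 ⇒ K-sparse ⇒ source-free datum, `…TwistingTHSparseGerm.stub_twistingTHSparse_of_localEmptyHypSF` p623876 ∘ `localTHEmptyHypSF_of_stubs`).  History (v4–v4.3): proved modulo the non-source-free local statement by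
the tree theorem `…LrcModEntireTwistingTHLocalHypGerm.stub_twistingTH_of_localEmptyHyp` (ns-poloidal-K2-p3 g7; v4 used p569136
`…TwistingTHLocal.stub_twistingTH_of_localEmpty` with the sign-free stub): same class hypotheses; on the
nonempty open `W` the profile is non-degenerate, the shear slope is a function of time alone on NO nonempty open subset of `W` (the item's pin),
the twist bracket `{∂₂v₂, v₂}ₕ` is NON-ZERO pointwise on `W`, AND the shear slope IS a function of time and height on `W`.  The reduction:
local analytic slope + pin ⇒ a base point with `∂_zμ ≠ 0` (`…TwistingTHLocalSlope`), a `C³` bump modification of the slope, K2-p2 g4's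
`horizFDeriv_weightSource_eq_zero` ⇒ the source is height-only ⇒ the analytic pressure datum `A`, the point data from non-degeneracy —
after RELOCATING to a hyperbolic twisting (TH) window (Theorem A class form + identity theorem, K2-p2 g6 p580224) so that `μ(p₀) < 0`. -/
theorem stub_twistingTH :
    ∀ (C : ℝ) (v : ℝ → EuclideanSpace ℝ (Fin 3) → EuclideanSpace ℝ (Fin 3)),
      Literature.Analysis.FluidPDE.HasTypeITimeDecay C v →
      ContinuousOn (Function.uncurry v) (Set.Iio (0 : ℝ) ×ˢ Set.univ) →
      (∀ s t : ℝ, s < t → t < 0 → ∀ x, v t x =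
        Literature.Analysis.UnboundedOperators.heatExtension (v s) (t - s) x -
          Literature.Analysis.FluidPDE.oseenDuhamel 1 s v v t x) →
      (∀ t < 0, Literature.Analysis.FluidPDE.VectorCalculus.IsDivFree (v t)) →
      (∀ s < 0, ∀ y, ⟪Literature.Analysis.FluidPDE.curl (v s) y, EuclideanSpace.single 2 1⟫_ℝ = 0) →
      ∀ W : Set (ℝ × EuclideanSpace ℝ (Fin 3)), IsOpen W → W.Nonempty → W ⊆ Set.Iio (0 : ℝ) ×ˢ Set.univ →
        (∀ z ∈ W, Literature.Analysis.FluidPDE.curl (v z.1) z.2 ≠ 0 ∧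
          (fderiv ℝ (v z.1) z.2 (EuclideanSpace.single 0 1) 2 ≠ 0 ∨ fderiv ℝ (v z.1) z.2 (EuclideanSpace.single 1 1) 2 ≠ 0) ∧
          (fderiv ℝ (v z.1) z.2 (EuclideanSpace.single 2 1) 0 ≠ 0 ∨ fderiv ℝ (v z.1) z.2 (EuclideanSpace.single 2 1) 1 ≠ 0)) →
        (∀ m : ℝ → ℝ, ∀ W₁ : Set (ℝ × EuclideanSpace ℝ (Fin 3)), W₁ ⊆ W → IsOpen W₁ → W₁.Nonempty →
          ∃ z ∈ W₁, ∃ b : Fin 3, b ≠ 2 ∧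
            fderiv ℝ (v z.1) z.2 (EuclideanSpace.single 2 1) b ≠
              m z.1 * fderiv ℝ (v z.1) z.2 (EuclideanSpace.single b 1) 2) →
        (∀ z ∈ W,
          fderiv ℝ (fun x => fderiv ℝ (v z.1) x (EuclideanSpace.single 2 1) 2) z.2 (EuclideanSpace.single 0 1) *
              fderiv ℝ (v z.1) z.2 (EuclideanSpace.single 1 1) 2 -
            fderiv ℝ (fun x => fderiv ℝ (v z.1) x (EuclideanSpace.single 2 1) 2) z.2 (EuclideanSpace.single 1 1) *
              fderiv ℝ (v z.1) z.2 (EuclideanSpace.single 0 1) 2 ≠ 0) →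
        (∃ m : ℝ → ℝ → ℝ, ∀ z ∈ W, ∀ b : Fin 3, b ≠ 2 →
          fderiv ℝ (v z.1) z.2 (EuclideanSpace.single 2 1) b =
            m z.1 (z.2 2) * fderiv ℝ (v z.1) z.2 (EuclideanSpace.single b 1) 2) →
        ∃ s : ℝ, s < 0 ∧ ∃ U : Set (EuclideanSpace ℝ (Fin 3)), IsOpen U ∧ U.Nonempty ∧
          ((∃ e : EuclideanSpace ℝ (Fin 3), e ≠ 0 ∧
              ∀ y ∈ U, fderiv ℝ (Literature.Analysis.FluidPDE.curl (v s)) y e = 0) ∨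
           (∃ c : EuclideanSpace ℝ (Fin 3), ∀ y ∈ U,
              Literature.Analysis.FluidPDE.rotGen (Literature.Analysis.FluidPDE.curl (v s) y) =
                fderiv ℝ (Literature.Analysis.FluidPDE.curl (v s)) y (Literature.Analysis.FluidPDE.rotGen (y - c))) ∨
           (∃ w : EuclideanSpace ℝ (Fin 3) → EuclideanSpace ℝ (Fin 3), AnalyticOnNhd ℝ w Set.univ ∧
              ¬ BddAbove (Set.range fun y => ‖w y‖) ∧ ∀ y ∈ U, v s y = w y)) :=
  fun C v hrate hcont hmild hdiv hpol W hW hWne hWs hnd hpin htw hTH => by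
    obtain ⟨K, hK0, hK⟩ := stub_scaledEnergy C v hrate hcont hmild hdiv
    exact Summit.NavierStokesRegularity.NavierStokesRegularity.Theorems.PoloidalWindowDoorLrcModEntireTwistingTHSparseGerm.stub_twistingTHSparse_of_localEmptyHypSF
      localTHEmptyHypSF_of_stubs C v hrate hcont hmild hdiv hpol K hK0 (fun t₀ ht₀ a R hR => (hK t₀ ht₀ a R hR).1)
      W hW hWne hWs hnd hpin htw hTH

/-- **STUB: NON-DEGENERATE + TWISTING on the THICK STRATUM ⇒ the germ trichotomy (THE RESEARCH RESIDUE).**  Same class hypotheses; on the nonempty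
open `W` the profile is non-degenerate, the twist bracket is non-zero pointwise, and the shear slope is a function of `(t, x₂)` on NO nonempty open subset
of `W` (`∇ₕΛ ≢ 0` locally: the thick stratum; this implies the item's pin).  Then the germ trichotomy holds.  Expected vacuous; handles: UNTWISTED-NOTE §5
(on a twisting germ the whole velocity is algebraic in the 3-jet of `v₂`: four scalar PDEs for one unknown), K2-p3 g5's AXIS theorem
(`…AxisKinematics13.deriv_centre_eq_zero`: «twisting ∧ per-plane isoparametric» is empty in the class), cert-1 g3 censuses (1)/(4) (untwisted-adjoined
far dimension; transversal rigidity at the constant-slope twisted solutions `…Negative.CrossedSuctionLayers`: does any K-a‴ bifurcate?), refuter1's K-a‴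
hunt (a twisting ND poloidal NS germ with NON-constant slope would show that this stub needs the class globally). -/
theorem stub_twistingThick :
    ∀ (C : ℝ) (v : ℝ → EuclideanSpace ℝ (Fin 3) → EuclideanSpace ℝ (Fin 3)),
      Literature.Analysis.FluidPDE.HasTypeITimeDecay C v →
      ContinuousOn (Function.uncurry v) (Set.Iio (0 : ℝ) ×ˢ Set.univ) →
      (∀ s t : ℝ, s < t → t < 0 → ∀ x, v t x =
        Literature.Analysis.UnboundedOperators.heatExtension (v s) (t - s) x -
          Literature.Analysis.FluidPDE.oseenDuhamel 1 s v v t x) →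
      (∀ t < 0, Literature.Analysis.FluidPDE.VectorCalculus.IsDivFree (v t)) →
      (∀ s < 0, ∀ y, ⟪Literature.Analysis.FluidPDE.curl (v s) y, EuclideanSpace.single 2 1⟫_ℝ = 0) →
      ∀ W : Set (ℝ × EuclideanSpace ℝ (Fin 3)), IsOpen W → W.Nonempty → W ⊆ Set.Iio (0 : ℝ) ×ˢ Set.univ →
        (∀ z ∈ W, Literature.Analysis.FluidPDE.curl (v z.1) z.2 ≠ 0 ∧
          (fderiv ℝ (v z.1) z.2 (EuclideanSpace.single 0 1) 2 ≠ 0 ∨ fderiv ℝ (v z.1) z.2 (EuclideanSpace.single 1 1) 2 ≠ 0) ∧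
          (fderiv ℝ (v z.1) z.2 (EuclideanSpace.single 2 1) 0 ≠ 0 ∨ fderiv ℝ (v z.1) z.2 (EuclideanSpace.single 2 1) 1 ≠ 0)) →
        (∀ m : ℝ → ℝ, ∀ W₁ : Set (ℝ × EuclideanSpace ℝ (Fin 3)), W₁ ⊆ W → IsOpen W₁ → W₁.Nonempty →
          ∃ z ∈ W₁, ∃ b : Fin 3, b ≠ 2 ∧
            fderiv ℝ (v z.1) z.2 (EuclideanSpace.single 2 1) b ≠
              m z.1 * fderiv ℝ (v z.1) z.2 (EuclideanSpace.single b 1) 2) →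
        (∀ z ∈ W,
          fderiv ℝ (fun x => fderiv ℝ (v z.1) x (EuclideanSpace.single 2 1) 2) z.2 (EuclideanSpace.single 0 1) *
              fderiv ℝ (v z.1) z.2 (EuclideanSpace.single 1 1) 2 -
            fderiv ℝ (fun x => fderiv ℝ (v z.1) x (EuclideanSpace.single 2 1) 2) z.2 (EuclideanSpace.single 1 1) *
              fderiv ℝ (v z.1) z.2 (EuclideanSpace.single 0 1) 2 ≠ 0) →
        (∀ m : ℝ → ℝ → ℝ, ∀ W₁ : Set (ℝ × EuclideanSpace ℝ (Fin 3)), W₁ ⊆ W → IsOpen W₁ → W₁.Nonempty →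
          ∃ z ∈ W₁, ∃ b : Fin 3, b ≠ 2 ∧
            fderiv ℝ (v z.1) z.2 (EuclideanSpace.single 2 1) b ≠
              m z.1 (z.2 2) * fderiv ℝ (v z.1) z.2 (EuclideanSpace.single b 1) 2) →
        ∃ s : ℝ, s < 0 ∧ ∃ U : Set (EuclideanSpace ℝ (Fin 3)), IsOpen U ∧ U.Nonempty ∧
          ((∃ e : EuclideanSpace ℝ (Fin 3), e ≠ 0 ∧
              ∀ y ∈ U, fderiv ℝ (Literature.Analysis.FluidPDE.curl (v s)) y e = 0) ∨
           (∃ c : EuclideanSpace ℝ (Fin 3), ∀ y ∈ U,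
              Literature.Analysis.FluidPDE.rotGen (Literature.Analysis.FluidPDE.curl (v s) y) =
                fderiv ℝ (Literature.Analysis.FluidPDE.curl (v s)) y (Literature.Analysis.FluidPDE.rotGen (y - c))) ∨
           (∃ w : EuclideanSpace ℝ (Fin 3) → EuclideanSpace ℝ (Fin 3), AnalyticOnNhd ℝ w Set.univ ∧
              ¬ BddAbove (Set.range fun y => ‖w y‖) ∧ ∀ y ∈ U, v s y = w y)) := by
  sorry

/-- **TWISTING ⇒ the germ trichotomy, from the two twisting stubs by the slope dichotomy (proved).**  On a twisting admissible `W`: either the slope is a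
function of `(t, x₂)` on some nonempty open `W₁ ⊆ W` (then `W₁` is admissible for `stub_twistingTH`: non-degeneracy, the pin and the twist restrict to
subsets) or it is so on no open subset (`stub_twistingThick` on `W`). -/
theorem twistingGerm_of_stubs :
    ∀ (C : ℝ) (v : ℝ → EuclideanSpace ℝ (Fin 3) → EuclideanSpace ℝ (Fin 3)),
      Literature.Analysis.FluidPDE.HasTypeITimeDecay C v →
      ContinuousOn (Function.uncurry v) (Set.Iio (0 : ℝ) ×ˢ Set.univ) →
      (∀ s t : ℝ, s < t → t < 0 → ∀ x, v t x =
        Literature.Analysis.UnboundedOperators.heatExtension (v s) (t - s) x -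
          Literature.Analysis.FluidPDE.oseenDuhamel 1 s v v t x) →
      (∀ t < 0, Literature.Analysis.FluidPDE.VectorCalculus.IsDivFree (v t)) →
      (∀ s < 0, ∀ y, ⟪Literature.Analysis.FluidPDE.curl (v s) y, EuclideanSpace.single 2 1⟫_ℝ = 0) →
      ∀ W : Set (ℝ × EuclideanSpace ℝ (Fin 3)), IsOpen W → W.Nonempty → W ⊆ Set.Iio (0 : ℝ) ×ˢ Set.univ →
        (∀ z ∈ W, Literature.Analysis.FluidPDE.curl (v z.1) z.2 ≠ 0 ∧
          (fderiv ℝ (v z.1) z.2 (EuclideanSpace.single 0 1) 2 ≠ 0 ∨ fderiv ℝ (v z.1) z.2 (EuclideanSpace.single 1 1) 2 ≠ 0) ∧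
          (fderiv ℝ (v z.1) z.2 (EuclideanSpace.single 2 1) 0 ≠ 0 ∨ fderiv ℝ (v z.1) z.2 (EuclideanSpace.single 2 1) 1 ≠ 0)) →
        (∀ m : ℝ → ℝ, ∀ W₁ : Set (ℝ × EuclideanSpace ℝ (Fin 3)), W₁ ⊆ W → IsOpen W₁ → W₁.Nonempty →
          ∃ z ∈ W₁, ∃ b : Fin 3, b ≠ 2 ∧
            fderiv ℝ (v z.1) z.2 (EuclideanSpace.single 2 1) b ≠
              m z.1 * fderiv ℝ (v z.1) z.2 (EuclideanSpace.single b 1) 2) →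
        (∀ z ∈ W,
          fderiv ℝ (fun x => fderiv ℝ (v z.1) x (EuclideanSpace.single 2 1) 2) z.2 (EuclideanSpace.single 0 1) *
              fderiv ℝ (v z.1) z.2 (EuclideanSpace.single 1 1) 2 -
            fderiv ℝ (fun x => fderiv ℝ (v z.1) x (EuclideanSpace.single 2 1) 2) z.2 (EuclideanSpace.single 1 1) *
              fderiv ℝ (v z.1) z.2 (EuclideanSpace.single 0 1) 2 ≠ 0) →
        ∃ s : ℝ, s < 0 ∧ ∃ U : Set (EuclideanSpace ℝ (Fin 3)), IsOpen U ∧ U.Nonempty ∧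
          ((∃ e : EuclideanSpace ℝ (Fin 3), e ≠ 0 ∧
              ∀ y ∈ U, fderiv ℝ (Literature.Analysis.FluidPDE.curl (v s)) y e = 0) ∨
           (∃ c : EuclideanSpace ℝ (Fin 3), ∀ y ∈ U,
              Literature.Analysis.FluidPDE.rotGen (Literature.Analysis.FluidPDE.curl (v s) y) =
                fderiv ℝ (Literature.Analysis.FluidPDE.curl (v s)) y (Literature.Analysis.FluidPDE.rotGen (y - c))) ∨
           (∃ w : EuclideanSpace ℝ (Fin 3) → EuclideanSpace ℝ (Fin 3), AnalyticOnNhd ℝ w Set.univ ∧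
              ¬ BddAbove (Set.range fun y => ‖w y‖) ∧ ∀ y ∈ U, v s y = w y)) := by
  intro C v hrate hcont hmild hdiv hpol W hW hWne hWs hnd hpin htw
  by_cases hTH : ∃ m : ℝ → ℝ → ℝ, ∃ W₁ : Set (ℝ × EuclideanSpace ℝ (Fin 3)), W₁ ⊆ W ∧ IsOpen W₁ ∧ W₁.Nonempty ∧
      ∀ z ∈ W₁, ∀ b : Fin 3, b ≠ 2 →
        fderiv ℝ (v z.1) z.2 (EuclideanSpace.single 2 1) b =
          m z.1 (z.2 2) * fderiv ℝ (v z.1) z.2 (EuclideanSpace.single b 1) 2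
  · obtain ⟨m, W₁, hW₁W, hW₁, hW₁ne, hid⟩ := hTH
    exact stub_twistingTH C v hrate hcont hmild hdiv hpol W₁ hW₁ hW₁ne (hW₁W.trans hWs)
      (fun z hz => hnd z (hW₁W hz)) (fun m' W₂ hW₂ hW₂o hW₂ne => hpin m' W₂ (hW₂.trans hW₁W) hW₂o hW₂ne)
      (fun z hz => htw z (hW₁W hz)) ⟨m, hid⟩
  · push Not at hTH
    have hthick : ∀ m : ℝ → ℝ → ℝ, ∀ W₁ : Set (ℝ × EuclideanSpace ℝ (Fin 3)), W₁ ⊆ W → IsOpen W₁ → W₁.Nonempty →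
        ∃ z ∈ W₁, ∃ b : Fin 3, b ≠ 2 ∧
          fderiv ℝ (v z.1) z.2 (EuclideanSpace.single 2 1) b ≠
            m z.1 (z.2 2) * fderiv ℝ (v z.1) z.2 (EuclideanSpace.single b 1) 2 := by
      intro m W₁ h1 h2 h3
      obtain ⟨z, hz, b, hb, hne⟩ := hTH m W₁ h1 h2 h3
      exact ⟨z, hz, b, hb, hne⟩
    exact stub_twistingThick C v hrate hcont hmild hdiv hpol W hW hWne hWs hnd hpin htw hthick

/-- **COMPOSITION (proved, no singularity hypothesis): `LrcModEntire` from the two stubs by the pointwise twist dichotomy.**  The twist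
bracket `T` is jointly continuous on the backward slab (joint analyticity of the Jacobian entries of a class profile and of their spatial
derivatives).  On an admissible `W`: either `T ≡ 0` on `W` (`stub_untwistedGerm`, the pin is not needed), or `W ∩ {T ≠ 0}` is a
nonempty open subset inheriting non-degeneracy and the pin (`twistingGerm_of_stubs`, i.e. the two twisting stubs). -/
theorem LrcModEntire_of_twistSplit : LrcModEntire := by
  intro C v hrate hcont hmild hdiv hpol W hW hWne hWs hnd hpin
  -- the twist bracket as a function on space–time
  set T : ℝ × EuclideanSpace ℝ (Fin 3) → ℝ := fun z =>
    fderiv ℝ (fun x => fderiv ℝ (v z.1) x (EuclideanSpace.single 2 1) 2) z.2 (EuclideanSpace.single 0 1) *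
              fderiv ℝ (v z.1) z.2 (EuclideanSpace.single 1 1) 2 -
            fderiv ℝ (fun x => fderiv ℝ (v z.1) x (EuclideanSpace.single 2 1) 2) z.2 (EuclideanSpace.single 1 1) *
              fderiv ℝ (v z.1) z.2 (EuclideanSpace.single 0 1) 2 with hT
  by_cases htw : ∃ z ∈ W, T z ≠ 0
  · -- TWISTING somewhere: restrict to the open set where `T ≠ 0`
    obtain ⟨z₀, hz₀W, hz₀⟩ := htw
    have hslab : IsOpen (Set.Iio (0 : ℝ) ×ˢ (Set.univ : Set (EuclideanSpace ℝ (Fin 3)))) :=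
      isOpen_Iio.prod isOpen_univ
    have hD : ∀ j i : Fin 3, ContinuousOn
        (fun z : ℝ × EuclideanSpace ℝ (Fin 3) => fderiv ℝ (v z.1) z.2 (EuclideanSpace.single j 1) i)
        (Set.Iio (0 : ℝ) ×ˢ Set.univ) := fun j i => continuousOn_fderiv_entry hrate hcont hmild j i
    have hD2 : ∀ b : Fin 3, ContinuousOn
        (fun z : ℝ × EuclideanSpace ℝ (Fin 3) =>
          fderiv ℝ (fun x => fderiv ℝ (v z.1) x (EuclideanSpace.single 2 1) 2) z.2 (EuclideanSpace.single b 1))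
        (Set.Iio (0 : ℝ) ×ˢ Set.univ) := by
      intro b
      have h22 := analyticOnNhd_uncurry_fderiv_entry hrate hcont hmild 2 2
      have h := analyticOnNhd_uncurry_fderiv_slice_apply (w := fun s y => fderiv ℝ (v s) y (EuclideanSpace.single 2 1) 2)
        h22 isOpen_Iio (v := fun _ _ => EuclideanSpace.single b 1) analyticOnNhd_const
      exact h.continuousOn
    have hTc : ContinuousOn T (Set.Iio (0 : ℝ) ×ˢ Set.univ) := by
      rw [hT]
      exact ((hD2 0).mul (hD 1 2)).sub ((hD2 1).mul (hD 0 2))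
    have hO : IsOpen ((Set.Iio (0 : ℝ) ×ˢ Set.univ) ∩ T ⁻¹' {0}ᶜ) :=
      hTc.isOpen_inter_preimage hslab isOpen_compl_singleton
    set W₃ : Set (ℝ × EuclideanSpace ℝ (Fin 3)) := W ∩ ((Set.Iio (0 : ℝ) ×ˢ Set.univ) ∩ T ⁻¹' {0}ᶜ) with hW₃
    have hW₃o : IsOpen W₃ := hW.inter hO
    have hW₃W : W₃ ⊆ W := Set.inter_subset_left
    have hW₃ne : W₃.Nonempty := ⟨z₀, hz₀W, hWs hz₀W, hz₀⟩
    refine twistingGerm_of_stubs C v hrate hcont hmild hdiv hpol W₃ hW₃o hW₃ne (hW₃W.trans hWs)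
      (fun z hz => hnd z (hW₃W hz)) (fun m W₁ hW₁ hW₁o hW₁ne => hpin m W₁ (hW₁.trans hW₃W) hW₁o hW₁ne) ?_
    intro z hz
    exact hz.2.2
  · -- UNTWISTED on all of `W`
    push Not at htw
    exact stub_untwistedGerm C v hrate hcont hmild hdiv hpol W hW hWne hWs hnd htw

/-! ### Transfer: one landing of a germ stub closes the K2 lead's v5 stub of 19708 as well -/

/-- **`stub_untwistedGerm` (this skeleton, germ currency) ⇒ the K2 lead's v5 `stub_untwisted` (19708, `¬ IsBackwardSingularPoint`
currency), VERBATIM** — inside the class the germ forces `v ≡ 0` (`…LrcModEntireIff.eq_zero_of_germ`), contradicting non-degeneracy at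
a point of `W`. -/
theorem stub_untwisted_of_germStub
    (hstub : ∀ (C : ℝ) (v : ℝ → EuclideanSpace ℝ (Fin 3) → EuclideanSpace ℝ (Fin 3)),
      Literature.Analysis.FluidPDE.HasTypeITimeDecay C v →
      ContinuousOn (Function.uncurry v) (Set.Iio (0 : ℝ) ×ˢ Set.univ) →
      (∀ s t : ℝ, s < t → t < 0 → ∀ x, v t x =
        Literature.Analysis.UnboundedOperators.heatExtension (v s) (t - s) x -
          Literature.Analysis.FluidPDE.oseenDuhamel 1 s v v t x) →
      (∀ t < 0, Literature.Analysis.FluidPDE.VectorCalculus.IsDivFree (v t)) →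
      (∀ s < 0, ∀ y, ⟪Literature.Analysis.FluidPDE.curl (v s) y, EuclideanSpace.single 2 1⟫_ℝ = 0) →
      ∀ W : Set (ℝ × EuclideanSpace ℝ (Fin 3)), IsOpen W → W.Nonempty → W ⊆ Set.Iio (0 : ℝ) ×ˢ Set.univ →
        (∀ z ∈ W, Literature.Analysis.FluidPDE.curl (v z.1) z.2 ≠ 0 ∧
          (fderiv ℝ (v z.1) z.2 (EuclideanSpace.single 0 1) 2 ≠ 0 ∨ fderiv ℝ (v z.1) z.2 (EuclideanSpace.single 1 1) 2 ≠ 0) ∧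
          (fderiv ℝ (v z.1) z.2 (EuclideanSpace.single 2 1) 0 ≠ 0 ∨ fderiv ℝ (v z.1) z.2 (EuclideanSpace.single 2 1) 1 ≠ 0)) →
        (∀ z ∈ W,
          fderiv ℝ (fun x => fderiv ℝ (v z.1) x (EuclideanSpace.single 2 1) 2) z.2 (EuclideanSpace.single 0 1) *
              fderiv ℝ (v z.1) z.2 (EuclideanSpace.single 1 1) 2 -
            fderiv ℝ (fun x => fderiv ℝ (v z.1) x (EuclideanSpace.single 2 1) 2) z.2 (EuclideanSpace.single 1 1) *
              fderiv ℝ (v z.1) z.2 (EuclideanSpace.single 0 1) 2 = 0) →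
        ∃ s : ℝ, s < 0 ∧ ∃ U : Set (EuclideanSpace ℝ (Fin 3)), IsOpen U ∧ U.Nonempty ∧
          ((∃ e : EuclideanSpace ℝ (Fin 3), e ≠ 0 ∧
              ∀ y ∈ U, fderiv ℝ (Literature.Analysis.FluidPDE.curl (v s)) y e = 0) ∨
           (∃ c : EuclideanSpace ℝ (Fin 3), ∀ y ∈ U,
              Literature.Analysis.FluidPDE.rotGen (Literature.Analysis.FluidPDE.curl (v s) y) =
                fderiv ℝ (Literature.Analysis.FluidPDE.curl (v s)) y (Literature.Analysis.FluidPDE.rotGen (y - c))) ∨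
           (∃ w : EuclideanSpace ℝ (Fin 3) → EuclideanSpace ℝ (Fin 3), AnalyticOnNhd ℝ w Set.univ ∧
              ¬ BddAbove (Set.range fun y => ‖w y‖) ∧ ∀ y ∈ U, v s y = w y))) :
    ∀ (C : ℝ) (v : ℝ → EuclideanSpace ℝ (Fin 3) → EuclideanSpace ℝ (Fin 3)),
      Literature.Analysis.FluidPDE.HasTypeITimeDecay C v →
      ContinuousOn (Function.uncurry v) (Set.Iio (0 : ℝ) ×ˢ Set.univ) →
      (∀ s t : ℝ, s < t → t < 0 → ∀ x, v t x =
        Literature.Analysis.UnboundedOperators.heatExtension (v s) (t - s) x -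
          Literature.Analysis.FluidPDE.oseenDuhamel 1 s v v t x) →
      (∀ t < 0, Literature.Analysis.FluidPDE.VectorCalculus.IsDivFree (v t)) →
      (∀ s < 0, ∀ y, ⟪Literature.Analysis.FluidPDE.curl (v s) y, EuclideanSpace.single 2 1⟫_ℝ = 0) →
      ∀ W : Set (ℝ × EuclideanSpace ℝ (Fin 3)), IsOpen W → W.Nonempty → W ⊆ Set.Iio (0 : ℝ) ×ˢ Set.univ →
        (∀ z ∈ W, Literature.Analysis.FluidPDE.curl (v z.1) z.2 ≠ 0 ∧
          (fderiv ℝ (v z.1) z.2 (EuclideanSpace.single 0 1) 2 ≠ 0 ∨ fderiv ℝ (v z.1) z.2 (EuclideanSpace.single 1 1) 2 ≠ 0) ∧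
          (fderiv ℝ (v z.1) z.2 (EuclideanSpace.single 2 1) 0 ≠ 0 ∨ fderiv ℝ (v z.1) z.2 (EuclideanSpace.single 2 1) 1 ≠ 0)) →
        (∀ z ∈ W,
          fderiv ℝ (fun x => fderiv ℝ (v z.1) x (EuclideanSpace.single 2 1) 2) z.2 (EuclideanSpace.single 0 1) *
              fderiv ℝ (v z.1) z.2 (EuclideanSpace.single 1 1) 2 -
            fderiv ℝ (fun x => fderiv ℝ (v z.1) x (EuclideanSpace.single 2 1) 2) z.2 (EuclideanSpace.single 1 1) *
              fderiv ℝ (v z.1) z.2 (EuclideanSpace.single 0 1) 2 = 0) →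
        ¬ Literature.Analysis.FluidPDE.IsBackwardSingularPoint v 0 := by
  intro C v hrate hcont hmild hdiv hpol W hW hWne hWs hnd htw
  obtain ⟨z₀, hz₀⟩ := hWne
  obtain ⟨s, hs, U, hU, hUne, hgerm⟩ := hstub C v hrate hcont hmild hdiv hpol W hW ⟨z₀, hz₀⟩ hWs hnd htw
  exact (false_of_germ_of_nondegenerate hrate hcont hmild hdiv hpol (Set.mem_prod.1 (hWs hz₀)).1 (hnd z₀ hz₀).1
    hs hU hUne hgerm).elim

/-- **`stub_twistingGerm` (this skeleton) ⇒ the K2 lead's v5 `stub_twisting` (19708), VERBATIM** — same argument. -/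
theorem stub_twisting_of_germStub
    (hstub : ∀ (C : ℝ) (v : ℝ → EuclideanSpace ℝ (Fin 3) → EuclideanSpace ℝ (Fin 3)),
      Literature.Analysis.FluidPDE.HasTypeITimeDecay C v →
      ContinuousOn (Function.uncurry v) (Set.Iio (0 : ℝ) ×ˢ Set.univ) →
      (∀ s t : ℝ, s < t → t < 0 → ∀ x, v t x =
        Literature.Analysis.UnboundedOperators.heatExtension (v s) (t - s) x -
          Literature.Analysis.FluidPDE.oseenDuhamel 1 s v v t x) →
      (∀ t < 0, Literature.Analysis.FluidPDE.VectorCalculus.IsDivFree (v t)) →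
      (∀ s < 0, ∀ y, ⟪Literature.Analysis.FluidPDE.curl (v s) y, EuclideanSpace.single 2 1⟫_ℝ = 0) →
      ∀ W : Set (ℝ × EuclideanSpace ℝ (Fin 3)), IsOpen W → W.Nonempty → W ⊆ Set.Iio (0 : ℝ) ×ˢ Set.univ →
        (∀ z ∈ W, Literature.Analysis.FluidPDE.curl (v z.1) z.2 ≠ 0 ∧
          (fderiv ℝ (v z.1) z.2 (EuclideanSpace.single 0 1) 2 ≠ 0 ∨ fderiv ℝ (v z.1) z.2 (EuclideanSpace.single 1 1) 2 ≠ 0) ∧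
          (fderiv ℝ (v z.1) z.2 (EuclideanSpace.single 2 1) 0 ≠ 0 ∨ fderiv ℝ (v z.1) z.2 (EuclideanSpace.single 2 1) 1 ≠ 0)) →
        (∀ m : ℝ → ℝ, ∀ W₁ : Set (ℝ × EuclideanSpace ℝ (Fin 3)), W₁ ⊆ W → IsOpen W₁ → W₁.Nonempty →
          ∃ z ∈ W₁, ∃ b : Fin 3, b ≠ 2 ∧
            fderiv ℝ (v z.1) z.2 (EuclideanSpace.single 2 1) b ≠
              m z.1 * fderiv ℝ (v z.1) z.2 (EuclideanSpace.single b 1) 2) →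
        (∀ z ∈ W,
          fderiv ℝ (fun x => fderiv ℝ (v z.1) x (EuclideanSpace.single 2 1) 2) z.2 (EuclideanSpace.single 0 1) *
              fderiv ℝ (v z.1) z.2 (EuclideanSpace.single 1 1) 2 -
            fderiv ℝ (fun x => fderiv ℝ (v z.1) x (EuclideanSpace.single 2 1) 2) z.2 (EuclideanSpace.single 1 1) *
              fderiv ℝ (v z.1) z.2 (EuclideanSpace.single 0 1) 2 ≠ 0) →
        ∃ s : ℝ, s < 0 ∧ ∃ U : Set (EuclideanSpace ℝ (Fin 3)), IsOpen U ∧ U.Nonempty ∧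
          ((∃ e : EuclideanSpace ℝ (Fin 3), e ≠ 0 ∧
              ∀ y ∈ U, fderiv ℝ (Literature.Analysis.FluidPDE.curl (v s)) y e = 0) ∨
           (∃ c : EuclideanSpace ℝ (Fin 3), ∀ y ∈ U,
              Literature.Analysis.FluidPDE.rotGen (Literature.Analysis.FluidPDE.curl (v s) y) =
                fderiv ℝ (Literature.Analysis.FluidPDE.curl (v s)) y (Literature.Analysis.FluidPDE.rotGen (y - c))) ∨
           (∃ w : EuclideanSpace ℝ (Fin 3) → EuclideanSpace ℝ (Fin 3), AnalyticOnNhd ℝ w Set.univ ∧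
              ¬ BddAbove (Set.range fun y => ‖w y‖) ∧ ∀ y ∈ U, v s y = w y))) :
    ∀ (C : ℝ) (v : ℝ → EuclideanSpace ℝ (Fin 3) → EuclideanSpace ℝ (Fin 3)),
      Literature.Analysis.FluidPDE.HasTypeITimeDecay C v →
      ContinuousOn (Function.uncurry v) (Set.Iio (0 : ℝ) ×ˢ Set.univ) →
      (∀ s t : ℝ, s < t → t < 0 → ∀ x, v t x =
        Literature.Analysis.UnboundedOperators.heatExtension (v s) (t - s) x -
          Literature.Analysis.FluidPDE.oseenDuhamel 1 s v v t x) →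
      (∀ t < 0, Literature.Analysis.FluidPDE.VectorCalculus.IsDivFree (v t)) →
      (∀ s < 0, ∀ y, ⟪Literature.Analysis.FluidPDE.curl (v s) y, EuclideanSpace.single 2 1⟫_ℝ = 0) →
      ∀ W : Set (ℝ × EuclideanSpace ℝ (Fin 3)), IsOpen W → W.Nonempty → W ⊆ Set.Iio (0 : ℝ) ×ˢ Set.univ →
        (∀ z ∈ W, Literature.Analysis.FluidPDE.curl (v z.1) z.2 ≠ 0 ∧
          (fderiv ℝ (v z.1) z.2 (EuclideanSpace.single 0 1) 2 ≠ 0 ∨ fderiv ℝ (v z.1) z.2 (EuclideanSpace.single 1 1) 2 ≠ 0) ∧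
          (fderiv ℝ (v z.1) z.2 (EuclideanSpace.single 2 1) 0 ≠ 0 ∨ fderiv ℝ (v z.1) z.2 (EuclideanSpace.single 2 1) 1 ≠ 0)) →
        (∀ m : ℝ → ℝ, ∀ W₁ : Set (ℝ × EuclideanSpace ℝ (Fin 3)), W₁ ⊆ W → IsOpen W₁ → W₁.Nonempty →
          ∃ z ∈ W₁, ∃ b : Fin 3, b ≠ 2 ∧
            fderiv ℝ (v z.1) z.2 (EuclideanSpace.single 2 1) b ≠
              m z.1 * fderiv ℝ (v z.1) z.2 (EuclideanSpace.single b 1) 2) →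
        (∀ z ∈ W,
          fderiv ℝ (fun x => fderiv ℝ (v z.1) x (EuclideanSpace.single 2 1) 2) z.2 (EuclideanSpace.single 0 1) *
              fderiv ℝ (v z.1) z.2 (EuclideanSpace.single 1 1) 2 -
            fderiv ℝ (fun x => fderiv ℝ (v z.1) x (EuclideanSpace.single 2 1) 2) z.2 (EuclideanSpace.single 1 1) *
              fderiv ℝ (v z.1) z.2 (EuclideanSpace.single 0 1) 2 ≠ 0) →
        ¬ Literature.Analysis.FluidPDE.IsBackwardSingularPoint v 0 := by
  intro C v hrate hcont hmild hdiv hpol W hW hWne hWs hnd hpin htw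
  obtain ⟨z₀, hz₀⟩ := hWne
  obtain ⟨s, hs, U, hU, hUne, hgerm⟩ := hstub C v hrate hcont hmild hdiv hpol W hW ⟨z₀, hz₀⟩ hWs hnd hpin htw
  exact (false_of_germ_of_nondegenerate hrate hcont hmild hdiv hpol (Set.mem_prod.1 (hWs hz₀)).1 (hnd z₀ hz₀).1
    hs hU hUne hgerm).elim

/-- **Crux K2 from this item's skeleton (proved modulo the two stubs; no new content)**: `LrcModEntire ⇒ K2` through the tree's
`…TimeShearClosed.nonflatLiouville_of_lrcSpatial` after killing the entire leg with `…EntireGerm`; unchanged from v1. -/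
theorem lrcModEntire_holds_of_twistSplit :
    ∀ (C : ℝ) (v : ℝ → EuclideanSpace ℝ (Fin 3) → EuclideanSpace ℝ (Fin 3)),
      Literature.Analysis.FluidPDE.HasTypeITimeDecay C v →
      ContinuousOn (Function.uncurry v) (Set.Iio (0 : ℝ) ×ˢ Set.univ) →
      (∀ s t : ℝ, s < t → t < 0 → ∀ x, v t x =
        Literature.Analysis.UnboundedOperators.heatExtension (v s) (t - s) x -
          Literature.Analysis.FluidPDE.oseenDuhamel 1 s v v t x) →
      (∀ t < 0, Literature.Analysis.FluidPDE.VectorCalculus.IsDivFree (v t)) →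
      (∀ s < 0, ∀ y, ⟪Literature.Analysis.FluidPDE.curl (v s) y, EuclideanSpace.single 2 1⟫_ℝ = 0) →
      ¬ Literature.Analysis.FluidPDE.IsBackwardSingularPoint v 0 := by
  intro C v hrate hcont hmild hdiv hpol
  refine Summit.NavierStokesRegularity.NavierStokesRegularity.Theorems.PoloidalWindowDoorPoloidalWindowRigidityTimeShearClosed.nonflatLiouville_of_lrcSpatial
    hrate hcont hmild hdiv hpol ?_
  intro W hW hWne hWs hnd hpin
  obtain ⟨s, hs, U, hU, hUne, halt⟩ := LrcModEntire_of_twistSplit C v hrate hcont hmild hdiv hpol W hW hWne hWs hnd hpin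
  rcases halt with htr | hrot | ⟨w, hw, hunb, heq⟩
  · exact ⟨s, hs, U, hU, hUne, Or.inl htr⟩
  · exact ⟨s, hs, U, hU, hUne, Or.inr hrot⟩
  · exact absurd heq (not_slice_eqOn_open_of_not_bddAbove hrate hcont hmild hs hw hunb hU hUne)

end Summit.NavierStokesRegularity.NavierStokesRegularity.Theses.PoloidalWindowDoor
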